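import Mathlib
import HarnessLib
import Summits.NavierStokesRegularity.NavierStokesRegularity.Theorems.PoloidalWindowDoorLrcModEntirePoleArgument

/-!
# Route `PoloidalWindowDoor`, item `LrcModEntire` (stmt-NavierStokesRegularity-20428), (Q4) column — B-POLE, DEGENERATE BRANCH `c′ ≡ 0` (TOWER-CLOSES §C2, last case)

Cell ns-regularity-ideate, LEAD-lineage seat ns-poloidal-K2-p3 g17 (`--supports stmt-NavierStokesRegularity-20428`).  Class-free.

When `c′ ≡ 0` on the height window the `ξ`-column of (P) vanishes and the 3×3 Cramer determinant of `…PoleArgument.pole_argument` is identically zero.  The same pole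
argument then runs with TWO heights and the non-degeneracy is AUTOMATIC:
★ `pole_argument_flat` — `K₀` infinite, `W ∖ {0}` infinite, `c ≠ 0` on `W`, (P₀) `υ(κ)·4c(m) − Z(κ)(1−κm)³ + (1−κm)³(e₀ + e₁κ + e₂κ² + e₃κ³)(m) = 0` on `K₀ × W`, two heights
`m₁ ≠ m₂` in `W ∖ {0}` ⊢ `∃ κ ∈ K₀, υ κ = 0`.  (2×2 Cramer: `υ·D = N` with `D(κ) = 4c(m₂)(1−κm₁)³ − 4c(m₁)(1−κm₂)³`, `D(1/m₁) = −4c(m₁)(1 − m₂/m₁)³ ≠ 0`; the third height gives a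
polynomial in `κ` vanishing on `K₀`, evaluated at `κ = 1/m`: `N(1/m)·4c(m) = 0`.)

WHAT THIS IS NOT: not a claim about Navier–Stokes regularity; class-free algebra for the research slots of registry twist_split v14.
-/

noncomputable section

set_option linter.dupNamespace false

namespace Summit.NavierStokesRegularity.NavierStokesRegularity.Theorems.PoloidalWindowDoorLrcModEntirePoleArgumentFlat

open Set Polynomial
open Summit.NavierStokesRegularity.NavierStokesRegularity.Theorems.PoloidalWindowDoorLrcModEntirePoleArgument

/-- ★ **B-POLE, degenerate branch** (`c′ ≡ 0`): see the module docstring. -/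
theorem pole_argument_flat {K₀ W : Set ℝ} (hK₀ : K₀.Infinite) (hW : (W \ {0}).Infinite)
    (υ Z c e₀ e₁ e₂ e₃ : ℝ → ℝ) (hc : ∀ m ∈ W, c m ≠ 0)
    (hP : ∀ κ ∈ K₀, ∀ m ∈ W,
      υ κ * (4 * c m) - Z κ * (1 - κ * m) ^ 3 + (1 - κ * m) ^ 3 * (e₀ m + e₁ m * κ + e₂ m * κ ^ 2 + e₃ m * κ ^ 3) = 0)
    {m₁ m₂ : ℝ} (hm₁ : m₁ ∈ W \ {0}) (hm₂ : m₂ ∈ W \ {0}) (hne : m₁ ≠ m₂) :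
    ∃ κ ∈ K₀, υ κ = 0 := by
  obtain ⟨hm₁W, hm₁0⟩ := hm₁
  obtain ⟨hm₂W, hm₂0⟩ := hm₂
  have hm₁0' : m₁ ≠ 0 := hm₁0
  have hm₂0' : m₂ ≠ 0 := hm₂0
  let Jc : ℝ → ℝ[X] := fun m => (1 - X * C m) ^ 3
  let Q : ℝ → ℝ[X] := fun m => (1 - X * C m) ^ 3 * (C (e₀ m) + C (e₁ m) * X + C (e₂ m) * X ^ 2 + C (e₃ m) * X ^ 3)
  have hJ : ∀ m κ, (Jc m).eval κ = (1 - κ * m) ^ 3 := by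
    intro m κ; simp only [Jc, eval_mul, eval_C, eval_pow, eval_sub, eval_one, eval_X]
  have hQ : ∀ m κ, (Q m).eval κ = (1 - κ * m) ^ 3 * (e₀ m + e₁ m * κ + e₂ m * κ ^ 2 + e₃ m * κ ^ 3) := by
    intro m κ; simp only [Q, eval_mul, eval_C, eval_pow, eval_add, eval_sub, eval_one, eval_X]
  -- 2×2 Cramer for the system  υ·4cᵢ − Z·jᵢ + qᵢ = 0 (i = 1,2):  υ·D = N, Z·D = N'
  let D : ℝ[X] := C (4 * c m₁) * (-Jc m₂) - (-Jc m₁) * C (4 * c m₂)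
  let N : ℝ[X] := (-Q m₁) * (-Jc m₂) - (-Jc m₁) * (-Q m₂)
  let N' : ℝ[X] := C (4 * c m₁) * (-Q m₂) - (-Q m₁) * C (4 * c m₂)
  have hCυ : ∀ κ ∈ K₀, υ κ * D.eval κ = N.eval κ := by
    intro κ hκ
    have h₁ := hP κ hκ m₁ hm₁W
    have h₂ := hP κ hκ m₂ hm₂W
    simp only [D, N, eval_sub, eval_mul, eval_neg, eval_C, hJ, hQ]
    linear_combination (-(1 - κ * m₂) ^ 3) * h₁ + ((1 - κ * m₁) ^ 3) * h₂
  have hCZ : ∀ κ ∈ K₀, Z κ * D.eval κ = N'.eval κ := by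
    intro κ hκ
    have h₁ := hP κ hκ m₁ hm₁W
    have h₂ := hP κ hκ m₂ hm₂W
    simp only [D, N', eval_sub, eval_mul, eval_neg, eval_C, hJ, hQ]
    linear_combination (-(4 * c m₂)) * h₁ + (4 * c m₁) * h₂
  -- the third height
  have hF : ∀ m ∈ W, N * C (4 * c m) - N' * Jc m + D * Q m = 0 := by
    intro m hm
    refine poly_eq_zero_of_eval_eq_zero_on hK₀ (fun κ hκ => ?_)
    simp only [eval_add, eval_sub, eval_mul, eval_C]
    rw [← hCυ κ hκ, ← hCZ κ hκ, hJ, hQ]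
    have h := hP κ hκ m hm
    linear_combination D.eval κ * h
  have hNroot : ∀ m ∈ W \ {0}, N.eval (1 / m) = 0 := by
    intro m hm
    obtain ⟨hmW, hm0⟩ := hm
    have hm0' : m ≠ 0 := hm0
    have h := congrArg (fun p : ℝ[X] => p.eval (1 / m)) (hF m hmW)
    simp only [eval_add, eval_sub, eval_mul, eval_zero, eval_C, hJ, hQ] at h
    have h1 : (1 - 1 / m * m) = 0 := by rw [one_div_mul_cancel hm0']; exact sub_self 1
    rw [h1] at h
    simp only [zero_pow three_ne_zero, mul_zero, zero_mul, add_zero, sub_zero] at h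
    have hc' : 4 * c m ≠ 0 := mul_ne_zero four_ne_zero (hc m hmW)
    have h' : N.eval (1 / m) * (4 * c m) = 0 := by linear_combination h
    exact (mul_eq_zero.1 h').resolve_right hc'
  have hN : N = 0 := by
    have hinj : Set.InjOn (fun m : ℝ => 1 / m) (W \ {0}) := fun a _ b _ hab => by simpa using hab
    refine poly_eq_zero_of_eval_eq_zero_on (hW.image hinj) (fun x hx => ?_)
    obtain ⟨m, hm, rfl⟩ := hx
    exact hNroot m hm
  -- non-degeneracy is automatic: D(1/m₁) = −4c(m₁)(1 − m₂/m₁)³ ≠ 0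
  have hDne : D ≠ 0 := by
    intro hD0
    have h := congrArg (fun p : ℝ[X] => p.eval (1 / m₁)) hD0
    simp only [D, eval_sub, eval_mul, eval_neg, eval_C, eval_zero, hJ] at h
    have h1 : (1 - 1 / m₁ * m₁) = 0 := by rw [one_div_mul_cancel hm₁0']; exact sub_self 1
    rw [h1] at h
    simp only [zero_pow three_ne_zero, neg_zero, zero_mul, sub_zero] at h
    -- h : 4 c(m₁) · (−(1 − m₂/m₁)³) = 0
    have hq : (1 - 1 / m₁ * m₂) ≠ 0 := by
      intro hq
      apply hne
      field_simp at hq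
      linarith
    have hc1 : 4 * c m₁ ≠ 0 := mul_ne_zero four_ne_zero (hc m₁ hm₁W)
    have : 4 * c m₁ * (-(1 - 1 / m₁ * m₂) ^ 3) ≠ 0 := mul_ne_zero hc1 (neg_ne_zero.2 (pow_ne_zero 3 hq))
    exact this (by linear_combination h)
  have hfin : {κ : ℝ | D.eval κ = 0}.Finite := by
    have hsub : {κ : ℝ | D.eval κ = 0} ⊆ (D.roots.toFinset : Set ℝ) := by
      intro κ hκ
      simp only [Multiset.mem_toFinset, Finset.mem_coe]
      exact (mem_roots hDne).2 hκ
    exact (Finset.finite_toSet _).subset hsub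
  obtain ⟨κ, hκ⟩ := (Set.Infinite.sdiff hK₀ hfin).nonempty
  refine ⟨κ, hκ.1, ?_⟩
  have h := hCυ κ hκ.1
  rw [hN, eval_zero] at h
  exact (mul_eq_zero.1 h).resolve_right hκ.2

end Summit.NavierStokesRegularity.NavierStokesRegularity.Theorems.PoloidalWindowDoorLrcModEntirePoleArgumentFlat

end
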